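import Summits.CriticalPhenomena.PercolationContinuityZ3.Theorems.PercNearOneGluingNoHeavyLowerTailPortSelection
import HarnessLib

/-!
# `NoHeavyLowerTail` (stmt-CriticalPhenomena-4575) — the lower tail is paid by the DISTINCT relays selected by the observer's
# relay-free cluster: CIL with constant = number of distinct Kozma–Nitzan witnesses

Lemma factory #6 (`prim-lf-6`, gen 4), 2026-08-19; corollary of the Steiner-blob decomposition and the port-selection lemma
(`…SteinerBlobContraction`, `…SteinerBlobMeasure`, `…PortSelection`).  For every selection `c` valid off the blobs,
`μ{1 ≤ N_o ≤ j} ≤ Σ_{u ∈ c(𝒱)} μ({N_o ≥ 1} ∩ {|π(u)| ≤ j}) ≤ |c(𝒱)| · max_a μ{|π(a)| ≤ j}` — the cumulative isolation inequality with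
constant the number of distinct relays the observer's relay-free cluster can designate (`1` recovers `tform_of_portDominated`; the k-uniform
candidate of the cell, `noHeavyLowerTail_of_portSelection`, asks for a constant independent of that number — conjecturally `2`).
No definitions, no sorries.
-/

namespace Summit.CriticalPhenomena.PercolationContinuityZ3.Theorems

open MeasureTheory Set Literature.Probability.LatticeModels Literature.Probability.Percolation
open scoped Classical BigOperators

variable {n : ℕ}

open SteinerBlob in
/-- **The lower tail is paid by the DISTINCT selected relays.**  For every selection `c` valid off the blobs (as in
`SteinerBlob.lowerTail_le_sum_selection`), `μ{1 ≤ N_o ≤ j} ≤ Σ_{u ∈ c(𝒱)} μ({N_o ≥ 1} ∩ {|π(u)| ≤ j})`, the sum running over the SET of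
relays selected by some blob `V₀ ∋ o` disjoint from `A` (regroup the selection sum by the selected relay and use the blob partition).  So the
cumulative isolation inequality holds with constant = the number of distinct Kozma–Nitzan witnesses the observer's relay-free cluster can
designate (`1` = `tform_of_portDominated`). [this work] -/
theorem lowerTail_le_sum_image_selection (w : Sym2 (Fin n) → unitInterval) (A : Finset (Fin n)) (o : Fin n) (j : ℕ)
    (hoA : o ∉ A) (c : Finset (Fin n) → Fin n)
    (hc : ∀ V₀ : Finset (Fin n), o ∈ V₀ → Disjoint V₀ A → c V₀ ∈ A ∧
      ∀ v ∈ A, (∃ u ∈ V₀, w s(u, v) ≠ 0) →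
        (prodBernoulli w).real {ω : BondConfig (Fin n) |
            (A.filter fun z => ω ∈ openConnIn ((↑V₀ : Set (Fin n))ᶜ) v z).card ≤ j} ≤
          (prodBernoulli w).real {ω : BondConfig (Fin n) |
            (A.filter fun z => ω ∈ openConnIn ((↑V₀ : Set (Fin n))ᶜ) (c V₀) z).card ≤ j}) :
    (prodBernoulli w).real {ω : BondConfig (Fin n) |
        1 ≤ (A.filter fun x => ω ∈ openConn o x).card ∧ (A.filter fun x => ω ∈ openConn o x).card ≤ j} ≤
      ∑ u ∈ ((Finset.univ : Finset (Finset (Fin n))).filter (fun V₀ => o ∈ V₀ ∧ Disjoint V₀ A)).image c,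
        (prodBernoulli w).real ({ω : BondConfig (Fin n) | 1 ≤ (A.filter fun x => ω ∈ openConn o x).card} ∩
          {ω : BondConfig (Fin n) | (A.filter fun x => ω ∈ openConn u x).card ≤ j}) := by
  set μ := prodBernoulli w with hμ
  set 𝒱 : Finset (Finset (Fin n)) :=
    (Finset.univ : Finset (Finset (Fin n))).filter (fun V₀ => o ∈ V₀ ∧ Disjoint V₀ A) with h𝒱
  set S : Fin n → Set (BondConfig (Fin n)) := fun u =>
    {ω : BondConfig (Fin n) | 1 ≤ (A.filter fun x => ω ∈ openConn o x).card} ∩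
      {ω : BondConfig (Fin n) | (A.filter fun x => ω ∈ openConn u x).card ≤ j} with hS
  set Bl : Finset (Fin n) → Set (BondConfig (Fin n)) := fun V₀ =>
    {ω : BondConfig (Fin n) | (∀ u ∈ V₀, ω ∈ openConnIn (↑V₀ : Set (Fin n)) o u) ∧
      ∀ u ∈ V₀, ∀ x, x ∉ V₀ → x ∉ A → s(u, x) ∉ ω} with hBl
  have h1 := lowerTail_le_sum_selection w A o j hoA c hc
  -- regroup the selection sum by the selected relay
  have h2 : ∑ V₀ ∈ 𝒱, μ.real (S (c V₀) ∩ Bl V₀) =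
      ∑ u ∈ 𝒱.image c, ∑ V₀ ∈ 𝒱.filter (fun V₀ => c V₀ = u), μ.real (S (c V₀) ∩ Bl V₀) :=
    (Finset.sum_fiberwise_of_maps_to (fun V₀ hV₀ => Finset.mem_image_of_mem c hV₀) _).symm
  -- each fibre is at most the full blob partition of `S u`
  have h3 : ∀ u ∈ 𝒱.image c,
      ∑ V₀ ∈ 𝒱.filter (fun V₀ => c V₀ = u), μ.real (S (c V₀) ∩ Bl V₀) ≤ μ.real (S u) := by
    intro u _
    calc ∑ V₀ ∈ 𝒱.filter (fun V₀ => c V₀ = u), μ.real (S (c V₀) ∩ Bl V₀)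
        = ∑ V₀ ∈ 𝒱.filter (fun V₀ => c V₀ = u), μ.real (S u ∩ Bl V₀) :=
          Finset.sum_congr rfl fun V₀ hV₀ => by rw [(Finset.mem_filter.1 hV₀).2]
      _ ≤ ∑ V₀ ∈ 𝒱, μ.real (S u ∩ Bl V₀) :=
          Finset.sum_le_sum_of_subset_of_nonneg (Finset.filter_subset _ _) fun _ _ _ => measureReal_nonneg
      _ = μ.real (S u) := sum_measureReal_inter_blob w A o hoA (S u)
  calc μ.real {ω : BondConfig (Fin n) |
          1 ≤ (A.filter fun x => ω ∈ openConn o x).card ∧ (A.filter fun x => ω ∈ openConn o x).card ≤ j}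
      ≤ ∑ V₀ ∈ 𝒱, μ.real (S (c V₀) ∩ Bl V₀) := h1
    _ = ∑ u ∈ 𝒱.image c, ∑ V₀ ∈ 𝒱.filter (fun V₀ => c V₀ = u), μ.real (S (c V₀) ∩ Bl V₀) := h2
    _ ≤ ∑ u ∈ 𝒱.image c, μ.real (S u) := Finset.sum_le_sum h3

open SteinerBlob in
/-- **CIL with constant the number of distinct selected relays.**  With a champion `a⋆` (`μ(R_a) ≤ μ(R_{a⋆})` for all `a ∈ A`) and a
valid selection `c`:  `μ{1 ≤ N_o ≤ j} ≤ |c(𝒱)| · μ{|π(a⋆)| ≤ j}`. [this work] -/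
theorem cumulativeIsolation_le_card_selection_mul (w : Sym2 (Fin n) → unitInterval) (A : Finset (Fin n)) (o a₀ : Fin n)
    (j : ℕ) (hoA : o ∉ A)
    (hchamp : ∀ a ∈ A, (prodBernoulli w).real {ω : BondConfig (Fin n) | (A.filter fun x => ω ∈ openConn a x).card ≤ j} ≤
      (prodBernoulli w).real {ω : BondConfig (Fin n) | (A.filter fun x => ω ∈ openConn a₀ x).card ≤ j})
    (c : Finset (Fin n) → Fin n)
    (hc : ∀ V₀ : Finset (Fin n), o ∈ V₀ → Disjoint V₀ A → c V₀ ∈ A ∧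
      ∀ v ∈ A, (∃ u ∈ V₀, w s(u, v) ≠ 0) →
        (prodBernoulli w).real {ω : BondConfig (Fin n) |
            (A.filter fun z => ω ∈ openConnIn ((↑V₀ : Set (Fin n))ᶜ) v z).card ≤ j} ≤
          (prodBernoulli w).real {ω : BondConfig (Fin n) |
            (A.filter fun z => ω ∈ openConnIn ((↑V₀ : Set (Fin n))ᶜ) (c V₀) z).card ≤ j}) :
    (prodBernoulli w).real {ω : BondConfig (Fin n) |
        1 ≤ (A.filter fun x => ω ∈ openConn o x).card ∧ (A.filter fun x => ω ∈ openConn o x).card ≤ j} ≤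
      (((Finset.univ : Finset (Finset (Fin n))).filter (fun V₀ => o ∈ V₀ ∧ Disjoint V₀ A)).image c).card *
        (prodBernoulli w).real {ω : BondConfig (Fin n) | (A.filter fun x => ω ∈ openConn a₀ x).card ≤ j} := by
  set μ := prodBernoulli w with hμ
  set 𝒱 : Finset (Finset (Fin n)) :=
    (Finset.univ : Finset (Finset (Fin n))).filter (fun V₀ => o ∈ V₀ ∧ Disjoint V₀ A) with h𝒱
  refine (lowerTail_le_sum_image_selection w A o j hoA c hc).trans ?_
  have hle : ∀ u ∈ 𝒱.image c,
      μ.real ({ω : BondConfig (Fin n) | 1 ≤ (A.filter fun x => ω ∈ openConn o x).card} ∩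
        {ω : BondConfig (Fin n) | (A.filter fun x => ω ∈ openConn u x).card ≤ j}) ≤
      μ.real {ω : BondConfig (Fin n) | (A.filter fun x => ω ∈ openConn a₀ x).card ≤ j} := by
    intro u hu
    obtain ⟨V₀, hV₀, rfl⟩ := Finset.mem_image.1 hu
    obtain ⟨ho, hVA⟩ := (Finset.mem_filter.1 hV₀).2
    exact (measureReal_mono Set.inter_subset_right (measure_ne_top _ _)).trans (hchamp _ (hc V₀ ho hVA).1)
  calc ∑ u ∈ 𝒱.image c, μ.real ({ω : BondConfig (Fin n) | 1 ≤ (A.filter fun x => ω ∈ openConn o x).card} ∩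
          {ω : BondConfig (Fin n) | (A.filter fun x => ω ∈ openConn u x).card ≤ j})
      ≤ ∑ u ∈ 𝒱.image c, μ.real {ω : BondConfig (Fin n) | (A.filter fun x => ω ∈ openConn a₀ x).card ≤ j} :=
        Finset.sum_le_sum hle
    _ = (𝒱.image c).card * μ.real {ω : BondConfig (Fin n) | (A.filter fun x => ω ∈ openConn a₀ x).card ≤ j} := by
        rw [Finset.sum_const, nsmul_eq_mul]

end Summit.CriticalPhenomena.PercolationContinuityZ3.Theorems
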